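import Summits.QuantumFields.BalabanUV.T4Continuum.Support.GradedSubBlocksPoincare
import Summits.QuantumFields.BalabanUV.T4Continuum.Support.CovariantBlockAveraging
import Summits.QuantumFields.BalabanUV.T4Continuum.Support.BalabanLineAverage

/-!
# T⁴ programme, spine node NE2 (U1a), sub-row Δ1 — THE GRADED WELL, leaf (GW-E) summand (E4), PART 2a: THE TWO OPERATOR-NORM BRICKS
# OF THE STRAIGHT-CONTOUR AVERAGE AT AN ARBITRARY SUB-BLOCK SCALE `s` — `‖Q_s‖ ≤ (√(s^d))⁻¹` and `‖Q_s·(S_1 − 1)‖ ≤ 2·s⁻¹·(√(s^d))⁻¹`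

NE2 formalisation swarm `b2b-balaban-t4-ne2-formalise-*`, LEAF PROVER 01 (gen 11).  Owner ruling R49 (journal `CLAIMS.log` 2026-08-21
l.≈25770): (GW-E) = (E1)+(E2)+(E3 ✓)+(E4), (E4) = the GRADED line-mass commutator (first refusal leaf-03 / leaf-01); leaf-03-g9's PART 1
`GradedLineAveragingPairing.sqrt_smul_avgS_JK_apply` (p246065 ✓, X3 ok l.26063) is the scale-`s` planted pairing identity
`√(L^d)·Q_{L·s}(J_L f) = Q_s((1 + c_L(S_1 − 1)) f) ∘ lift`; INTENT l.26098.  THIS FILE supplies, for the owner's `GradedSubBlocks.avgS N s`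
(O16-a, p244783) on ONE torus and with NO two-level data, the two operator-norm inputs that E3's unit proof
(`LineAveragingMassCommutator.opNorm_JK_massComm_le`) takes from `CovariantBlockAveraging.opNorm_QvOp_le` and
`LineAveragingTwoLevel.opNorm_QvOp_mul_shiftT_sub_one_le`:

 * §1 the entries of `avgS` are nonnegative reals; ROW sums `≤ 1` (every straight contour system of a sub-block has total weight `1`:
   `sum_inSub`) and COLUMN sums `≤ s^{−d}` (a fine bond lies on exactly `s` contours, one per start site, all in ONE sub-block:
   `sum_anchor_inSub`) ⟹ **`opNorm_avgS_le (hs : ∀ ν, s ∣ N ν) : ‖avgS N s‖ ≤ (√(s^d))⁻¹`** (rectangular Schur).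
 * §2 **`avgS_shiftT_sub_one_mulVec`**: `(Q_s(S_1 − 1)f)(z, μ) = s^{−(d+1)}·Σ_j (f(z + j + s e_μ, μ) − f(z + j, μ))` — the straight contours
   TELESCOPE to the far faces (`avgS_mulVec` + `sum_fin_telescope`); hence **`opNorm_avgS_mul_shiftT_sub_one_le (hs) :
   ‖avgS N s * (shiftT N 1 − 1)‖ ≤ 2·s⁻¹·(√(s^d))⁻¹`** (Cauchy–Schwarz per row + the partition `sum_sites_eq` of the torus into sub-blocks)
   — the boundary transfer of PART 1's identity is `O(s⁻¹)` in operator norm, no regularity of the field.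
 What remains of (E4) PART 2: the scale-`s` twin of `LineAveragingTwoLevelPairing.opNorm_QvOp_mul_Qavg_sub_le` and E3's assembly per layer,
 both pairing rows ACROSS levels (the owner's file 4 `rowVLift`).

HONEST FRAMING (T4-DAG p. 1).  [folklore] finite-torus combinatorics at `U = 1`; statements and proofs OURS about OUR typed averaging objects;
no two-level law, no rate; (E4) PART 2 / (GW-E) / the graded-well `hinjK` OPEN; NE2 (U1a) NOT proved; spine PROVED 0/9 unchanged; NOT [B9]
(3.16)/(3.23)–(3.27)/(3.42) as printed; NOT infinite volume, NOT a mass gap, NOT the Clay problem.  HONEST DEPENDENCY: continuum YM on T⁴ ⇐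
BetaPertH ∧ nine spine estimates (0/9 proved); BetaPertH ⇐ (D1) ∧ (D4) ∧ CAP+tail; G-an2-4 gates asym, D1 and NE2/3/4.  No `sorry`.
-/

noncomputable section

open scoped BigOperators ComplexConjugate Matrix Matrix.Norms.L2Operator
open Finset

namespace Summit.QuantumFields.BalabanUV.T4Continuum.GradedLineAveragingBounds

open Literature.MathematicalPhysics.QuantumFieldTheory.Balaban1983to89.B5Prop11Plancherel (Tor unitVec)
open Literature.MathematicalPhysics.QuantumFieldTheory.Balaban1983to89.B5Block118 (tstep tstep_zero tstep_succ sum_fin_telescope)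
open Summit.QuantumFields.BalabanUV.T4Continuum
open Summit.QuantumFields.BalabanUV.T4Continuum.BalabanLineAverage (shiftT tstep_one)
open Summit.QuantumFields.BalabanUV.T4Continuum.CovariantBlockAveraging (opNorm_le_of_sq_le' opNorm_le_sqrt_of_schur)
open Summit.QuantumFields.BalabanUV.T4Continuum.GradedSubBlocks (Anchor Anc InSub site meanS avgS avgS_mulVec sum_inSub)
open Summit.QuantumFields.BalabanUV.T4Continuum.GradedSubBlocksRefine (anchorOf inSub_anchorOf eq_anchorOf_of_inSub)
open Summit.QuantumFields.BalabanUV.T4Continuum.GradedSubBlocksPoincare (sum_sites_eq)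

variable {d : ℕ} (N : Fin d → ℕ) [hN : ∀ ν, NeZero (N ν)] (s : ℕ) [NeZero s]

/-! ## §1 Row and column sums of the straight-contour average; its operator norm -/

omit hN [NeZero s] in
/-- the entries of the scalar sub-block mean are `s^{−d}·[y ∈ B_s(z)]`: norm `s^{−d}` or `0`. [folklore] -/
theorem norm_meanS (z : Anc N s) (y : Tor N) :
    ‖meanS N s z y‖ = if InSub N s z.1 y then ((s : ℝ) ^ d)⁻¹ else 0 := by
  unfold meanS
  split_ifs
  · rw [norm_inv, norm_pow, Complex.norm_natCast]
  · exact norm_zero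

/-- the total mass of one sub-block mean row is `1`: `Σ_y s^{−d}·[y ∈ B_s(z)] = 1`. [folklore] -/
theorem sum_norm_meanS_row (hs : ∀ ν, s ∣ N ν) (z : Anc N s) : ∑ y, ‖meanS N s z y‖ = 1 := by
  have hsd : ((s : ℝ) ^ d) ≠ 0 := pow_ne_zero _ (by exact_mod_cast NeZero.ne s)
  have hC : ((∑ y, ‖meanS N s z y‖ : ℝ) : ℂ) = ((1 : ℝ) : ℂ) := by
    push_cast
    have e1 : ∀ y, ((‖meanS N s z y‖ : ℝ) : ℂ) = if InSub N s z.1 y then (((s : ℂ) ^ d)⁻¹) else 0 := fun y => by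
      rw [norm_meanS]; split_ifs <;> push_cast <;> rfl
    simp_rw [e1]
    rw [sum_inSub N s hs z.2 (fun _ => ((s : ℂ) ^ d)⁻¹), Finset.sum_const, Finset.card_univ, Fintype.card_fun, Fintype.card_fin,
      Fintype.card_fin, nsmul_eq_mul]
    have hsc : ((s : ℂ) ^ d) ≠ 0 := pow_ne_zero _ (by exact_mod_cast NeZero.ne s)
    push_cast
    field_simp
  exact_mod_cast hC

/-- a site lies in exactly one sub-block: `Σ_z s^{−d}·[y ∈ B_s(z)] = s^{−d}`. [folklore] -/
theorem sum_norm_meanS_col (y : Tor N) : ∑ z : Anc N s, ‖meanS N s z y‖ = ((s : ℝ) ^ d)⁻¹ := by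
  simp_rw [norm_meanS]
  rw [Finset.sum_eq_single (anchorOf N s y)]
  · rw [if_pos (inSub_anchorOf N s y)]
  · intro w _ hw
    rw [if_neg]
    exact fun h => hw (eq_anchorOf_of_inSub N s h)
  · exact fun h => absurd (Finset.mem_univ _) h

omit hN [NeZero s] in
/-- the entries of the straight-contour average. [folklore] -/
theorem avgS_apply (b : Anc N s × Fin d) (i : Tor N × Fin d) :
    avgS N s b i = if i.2 = b.2 then (s : ℂ)⁻¹ * ∑ t : Fin s, meanS N s b.1 (i.1 - tstep N b.2 t) else 0 := rfl

omit hN [NeZero s] in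
/-- entrywise bound: `|Q_s((z,μ),(x,μ′))| ≤ [μ′ = μ]·s⁻¹·Σ_{t<s} s^{−d}[x − t e_μ ∈ B_s(z)]`. [folklore] -/
theorem norm_avgS_le (b : Anc N s × Fin d) (i : Tor N × Fin d) :
    ‖avgS N s b i‖ ≤ if i.2 = b.2 then (s : ℝ)⁻¹ * ∑ t : Fin s, ‖meanS N s b.1 (i.1 - tstep N b.2 t)‖ else 0 := by
  rw [avgS_apply]
  split_ifs
  · rw [norm_mul, norm_inv, Complex.norm_natCast]
    exact mul_le_mul_of_nonneg_left (norm_sum_le _ _) (inv_nonneg.mpr (Nat.cast_nonneg _))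
  · rw [norm_zero]

/-- **ROW SUMS**: `Σ_i |Q_s(b, i)| ≤ 1`. [folklore] -/
theorem sum_norm_avgS_row_le (hs : ∀ ν, s ∣ N ν) (b : Anc N s × Fin d) : ∑ i, ‖avgS N s b i‖ ≤ 1 := by
  have hs0 : (0 : ℝ) < s := by exact_mod_cast Nat.pos_of_ne_zero (NeZero.ne s)
  obtain ⟨z, μ⟩ := b
  calc ∑ i, ‖avgS N s (z, μ) i‖
      ≤ ∑ i : Tor N × Fin d, (if i.2 = μ then (s : ℝ)⁻¹ * ∑ t : Fin s, ‖meanS N s z (i.1 - tstep N μ t)‖ else 0) :=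
        Finset.sum_le_sum fun i _ => norm_avgS_le N s (z, μ) i
    _ = ∑ x : Tor N, (s : ℝ)⁻¹ * ∑ t : Fin s, ‖meanS N s z (x - tstep N μ t)‖ := by
        rw [Fintype.sum_prod_type]
        refine Finset.sum_congr rfl fun x _ => ?_
        rw [Finset.sum_ite_eq' Finset.univ μ]
        simp only [Finset.mem_univ, if_true]
    _ = (s : ℝ)⁻¹ * ∑ t : Fin s, ∑ x : Tor N, ‖meanS N s z (x - tstep N μ t)‖ := by rw [← Finset.mul_sum, Finset.sum_comm]
    _ = (s : ℝ)⁻¹ * ∑ _t : Fin s, (1 : ℝ) := by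
        congr 1
        refine Finset.sum_congr rfl fun t _ => ?_
        rw [← sum_norm_meanS_row N s hs z]
        exact Fintype.sum_equiv (Equiv.subRight (tstep N μ (t : ℕ))) _ _ fun x => rfl
    _ = 1 := by rw [Finset.sum_const, Finset.card_univ, Fintype.card_fin, nsmul_eq_mul, mul_one, inv_mul_cancel₀ hs0.ne']

/-- **COLUMN SUMS**: `Σ_b |Q_s(b, i)| ≤ s^{−d}`. [folklore] -/
theorem sum_norm_avgS_col_le (i : Tor N × Fin d) : ∑ b, ‖avgS N s b i‖ ≤ ((s : ℝ) ^ d)⁻¹ := by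
  have hs0 : (0 : ℝ) < s := by exact_mod_cast Nat.pos_of_ne_zero (NeZero.ne s)
  obtain ⟨x, μ⟩ := i
  calc ∑ b, ‖avgS N s b (x, μ)‖
      ≤ ∑ b : Anc N s × Fin d, (if μ = b.2 then (s : ℝ)⁻¹ * ∑ t : Fin s, ‖meanS N s b.1 (x - tstep N b.2 t)‖ else 0) :=
        Finset.sum_le_sum fun b _ => norm_avgS_le N s b (x, μ)
    _ = ∑ z : Anc N s, (s : ℝ)⁻¹ * ∑ t : Fin s, ‖meanS N s z (x - tstep N μ t)‖ := by
        rw [Fintype.sum_prod_type]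
        refine Finset.sum_congr rfl fun z _ => ?_
        rw [Finset.sum_ite_eq Finset.univ μ]
        simp only [Finset.mem_univ, if_true]
    _ = (s : ℝ)⁻¹ * ∑ t : Fin s, ∑ z : Anc N s, ‖meanS N s z (x - tstep N μ t)‖ := by rw [← Finset.mul_sum, Finset.sum_comm]
    _ = (s : ℝ)⁻¹ * ∑ _t : Fin s, ((s : ℝ) ^ d)⁻¹ := by
        congr 1
        exact Finset.sum_congr rfl fun t _ => sum_norm_meanS_col N s (x - tstep N μ t)
    _ = ((s : ℝ) ^ d)⁻¹ := by
        rw [Finset.sum_const, Finset.card_univ, Fintype.card_fin, nsmul_eq_mul, ← mul_assoc, inv_mul_cancel₀ hs0.ne', one_mul]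

/-- **`‖Q_s‖ ≤ (√(s^d))⁻¹`** — the straight-contour average at scale `s` is a contraction up to the isometric factor (the scale-`s` twin of
`CovariantBlockAveraging.opNorm_QvOp_le`). [folklore] -/
theorem opNorm_avgS_le (hs : ∀ ν, s ∣ N ν) : ‖avgS N s‖ ≤ (Real.sqrt ((s : ℝ) ^ d))⁻¹ := by
  have hsd : (0 : ℝ) < (s : ℝ) ^ d := pow_pos (by exact_mod_cast Nat.pos_of_ne_zero (NeZero.ne s)) d
  refine (opNorm_le_sqrt_of_schur _ zero_le_one (inv_nonneg.mpr hsd.le) (sum_norm_avgS_row_le N s hs) (sum_norm_avgS_col_le N s)).trans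
    (le_of_eq ?_)
  rw [one_mul, Real.sqrt_inv]

/-! ## §2 The boundary transfer `Q_s·(S_1 − 1)`: the contours telescope to the far faces -/

/-- the own-direction translation on fields of a general torus: `(S_t f)(x, μ) = f(x + t e_μ, μ)`. [folklore] -/
theorem shiftT_mulVec' (t : ℕ) (f : Tor N × Fin d → ℂ) (i : Tor N × Fin d) :
    (shiftT N t *ᵥ f) i = f (i.1 + tstep N i.2 t, i.2) := by
  simp only [Matrix.mulVec, dotProduct, shiftT, ite_mul, one_mul, zero_mul]
  rw [Finset.sum_ite_eq']
  simp

/-- **THE STRAIGHT CONTOURS OF `S_1 f − f` TELESCOPE**: `(Q_s(S_1 − 1)f)(z, μ) = s^{−(d+1)}·Σ_j (f(z + j + s e_μ, μ) − f(z + j, μ))`. [folklore] -/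
theorem avgS_shiftT_sub_one_mulVec (hs : ∀ ν, s ∣ N ν) (f : Tor N × Fin d → ℂ) (z : Anc N s) (μ : Fin d) :
    ((avgS N s * (shiftT N 1 - 1)) *ᵥ f) (z, μ)
      = ((s : ℂ) ^ (d + 1))⁻¹
          * ∑ j : Fin d → Fin s, (f (site N s z.1 j + tstep N μ s, μ) - f (site N s z.1 j, μ)) := by
  rw [← Matrix.mulVec_mulVec, avgS_mulVec N s hs _ z μ]
  congr 1
  refine Finset.sum_congr rfl fun j _ => ?_
  have e : ∀ t : Fin s, ((shiftT N 1 - 1) *ᵥ f) (site N s z.1 j + tstep N μ t, μ)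
      = f (site N s z.1 j + tstep N μ ((t : ℕ) + 1), μ) - f (site N s z.1 j + tstep N μ t, μ) := by
    intro t
    rw [Matrix.sub_mulVec, Matrix.one_mulVec, Pi.sub_apply, shiftT_mulVec', tstep_one, tstep_succ, add_assoc]
  simp_rw [e]
  rw [sum_fin_telescope (fun σ => f (site N s z.1 j + tstep N μ σ, μ)) s, tstep_zero, add_zero]

/-- **`‖Q_s·(S_1 − 1)‖ ≤ 2·s⁻¹·(√(s^d))⁻¹`** — the boundary-transfer operator of the scale-`s` planted pairing identity is small in OPERATOR
NORM (the scale-`s` twin of `LineAveragingTwoLevel.opNorm_QvOp_mul_shiftT_sub_one_le`; no regularity of the field). [folklore] -/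
theorem opNorm_avgS_mul_shiftT_sub_one_le (hs : ∀ ν, s ∣ N ν) :
    ‖avgS N s * (shiftT N 1 - 1)‖ ≤ 2 * ((s : ℝ))⁻¹ * (Real.sqrt ((s : ℝ) ^ d))⁻¹ := by
  have hs0 : (0 : ℝ) < s := by exact_mod_cast Nat.pos_of_ne_zero (NeZero.ne s)
  have hsd : (0 : ℝ) < (s : ℝ) ^ d := pow_pos hs0 d
  set X := avgS N s * (shiftT N 1 - 1) with hX
  refine opNorm_le_of_sq_le' X (by positivity) fun f => ?_
  have e0 : ∑ b, ‖∑ i, X b i * f i‖ ^ 2 = ∑ b, ‖(X *ᵥ f) b‖ ^ 2 := rfl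
  rw [e0, Fintype.sum_prod_type]
  simp only [hX, avgS_shiftT_sub_one_mulVec N s hs]
  have hc : ‖(((s : ℂ) ^ (d + 1))⁻¹)‖ = ((s : ℝ) ^ (d + 1))⁻¹ := by rw [norm_inv, norm_pow, Complex.norm_natCast]
  -- the per-row bound
  have hterm : ∀ (z : Anc N s) (μ : Fin d),
      ‖((s : ℂ) ^ (d + 1))⁻¹ * ∑ j : Fin d → Fin s, (f (site N s z.1 j + tstep N μ s, μ) - f (site N s z.1 j, μ))‖ ^ 2
        ≤ (((s : ℝ) ^ (d + 1))⁻¹) ^ 2 * ((s : ℝ) ^ d * (2 *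
            (∑ j : Fin d → Fin s, ‖f (site N s z.1 j + tstep N μ s, μ)‖ ^ 2
              + ∑ j : Fin d → Fin s, ‖f (site N s z.1 j, μ)‖ ^ 2))) := by
    intro z μ
    rw [norm_mul, mul_pow, hc]
    refine mul_le_mul_of_nonneg_left ?_ (sq_nonneg _)
    have h1 : ‖∑ j : Fin d → Fin s, (f (site N s z.1 j + tstep N μ s, μ) - f (site N s z.1 j, μ))‖ ^ 2
        ≤ (univ : Finset (Fin d → Fin s)).card
            * ∑ j : Fin d → Fin s, ‖f (site N s z.1 j + tstep N μ s, μ) - f (site N s z.1 j, μ)‖ ^ 2 :=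
      (pow_le_pow_left₀ (norm_nonneg _) (norm_sum_le _ _) 2).trans sq_sum_le_card_mul_sum_sq
    simp only [card_univ, Fintype.card_fun, Fintype.card_fin] at h1
    push_cast at h1
    refine h1.trans ?_
    refine mul_le_mul_of_nonneg_left ?_ hsd.le
    rw [mul_add, mul_sum, mul_sum, ← sum_add_distrib]
    refine sum_le_sum fun j _ => ?_
    have hsub : ‖f (site N s z.1 j + tstep N μ s, μ) - f (site N s z.1 j, μ)‖
        ≤ ‖f (site N s z.1 j + tstep N μ s, μ)‖ + ‖f (site N s z.1 j, μ)‖ := norm_sub_le _ _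
    nlinarith [norm_nonneg (f (site N s z.1 j + tstep N μ s, μ) - f (site N s z.1 j, μ)), norm_nonneg (f (site N s z.1 j + tstep N μ s, μ)),
      norm_nonneg (f (site N s z.1 j, μ)), sq_nonneg (‖f (site N s z.1 j + tstep N μ s, μ)‖ - ‖f (site N s z.1 j, μ)‖)]
  refine (sum_le_sum fun z _ => sum_le_sum fun μ _ => hterm z μ).trans ?_
  -- both site sums are `Σ_i ‖f i‖²` (the torus is the disjoint union of the sub-blocks; the far faces are a translate)
  have hSA : ∑ z : Anc N s, ∑ μ : Fin d, ∑ j : Fin d → Fin s, ‖f (site N s z.1 j + tstep N μ s, μ)‖ ^ 2 = ∑ i, ‖f i‖ ^ 2 := by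
    calc ∑ z : Anc N s, ∑ μ : Fin d, ∑ j : Fin d → Fin s, ‖f (site N s z.1 j + tstep N μ s, μ)‖ ^ 2
        = ∑ μ : Fin d, ∑ z : Anc N s, ∑ j : Fin d → Fin s, ‖f (site N s z.1 j + tstep N μ s, μ)‖ ^ 2 := sum_comm
      _ = ∑ μ : Fin d, ∑ x : Tor N, ‖f (x + tstep N μ s, μ)‖ ^ 2 :=
          sum_congr rfl fun μ _ => (sum_sites_eq N s hs (fun x => ‖f (x + tstep N μ s, μ)‖ ^ 2)).symm
      _ = ∑ μ : Fin d, ∑ x : Tor N, ‖f (x, μ)‖ ^ 2 :=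
          sum_congr rfl fun μ _ => Fintype.sum_equiv (Equiv.addRight (tstep N μ s)) _ _ fun x => rfl
      _ = ∑ x : Tor N, ∑ μ : Fin d, ‖f (x, μ)‖ ^ 2 := sum_comm
      _ = ∑ i, ‖f i‖ ^ 2 := by rw [Fintype.sum_prod_type]
  have hSB : ∑ z : Anc N s, ∑ μ : Fin d, ∑ j : Fin d → Fin s, ‖f (site N s z.1 j, μ)‖ ^ 2 = ∑ i, ‖f i‖ ^ 2 := by
    calc ∑ z : Anc N s, ∑ μ : Fin d, ∑ j : Fin d → Fin s, ‖f (site N s z.1 j, μ)‖ ^ 2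
        = ∑ μ : Fin d, ∑ z : Anc N s, ∑ j : Fin d → Fin s, ‖f (site N s z.1 j, μ)‖ ^ 2 := sum_comm
      _ = ∑ μ : Fin d, ∑ x : Tor N, ‖f (x, μ)‖ ^ 2 :=
          sum_congr rfl fun μ _ => (sum_sites_eq N s hs (fun x => ‖f (x, μ)‖ ^ 2)).symm
      _ = ∑ x : Tor N, ∑ μ : Fin d, ‖f (x, μ)‖ ^ 2 := sum_comm
      _ = ∑ i, ‖f i‖ ^ 2 := by rw [Fintype.sum_prod_type]
  have htot : ∑ z : Anc N s, ∑ μ : Fin d, (((s : ℝ) ^ (d + 1))⁻¹) ^ 2 * ((s : ℝ) ^ d * (2 *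
            (∑ j : Fin d → Fin s, ‖f (site N s z.1 j + tstep N μ s, μ)‖ ^ 2
              + ∑ j : Fin d → Fin s, ‖f (site N s z.1 j, μ)‖ ^ 2)))
      = (((s : ℝ) ^ (d + 1))⁻¹) ^ 2 * ((s : ℝ) ^ d * (2 * (∑ i, ‖f i‖ ^ 2 + ∑ i, ‖f i‖ ^ 2))) := by
    simp_rw [← mul_sum]
    simp_rw [sum_add_distrib]
    rw [hSA, hSB]
  rw [htot, mul_pow, mul_pow, inv_pow (Real.sqrt _), Real.sq_sqrt hsd.le]
  have hs1 : (s : ℝ) ≠ 0 := hs0.ne'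
  apply le_of_eq
  field_simp
  ring

end Summit.QuantumFields.BalabanUV.T4Continuum.GradedLineAveragingBounds

end
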